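import Literature.NumberTheory.EllipticCurves.TwoDescentLocalExhibits
import Literature.NumberTheory.QuadraticForms.PadicHilbertSymbol
import HarnessLib

/-!
# From a local exhibit to the local Selmer condition, over the completions of `ℚ`

Companion of `TwoDescentLocalExhibits.lean` (torsion / explicit-point exhibits, square criteria) and
`TwoDescentKummerBridgeConverse.lean` (a descent pair is a local Kummer class): for an elliptic curve `E/ℚ`
with rational `2`-torsion `e₁, e₂, e₃` and the class `c(a, b) = twoDescentClass h a b ∈ H¹(ℚ, E[2])` with
components `([a], [b])` (`TwoDescentClassOfPair.lean`), this file packages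

* §1 the rational SQUARE TESTS at the places of `ℚ` (Serre, *A Course in Arithmetic* II §3.3 Thm 3/4): at a
  finite place `v` over an odd prime `ℓ`, `parityBit ℓ q = 0 ∧ qrBit ℓ q = 0 ⟹ q ∈ ℚ_v²`
  (`isSquare_algebraMap_adicCompletion_of_bits`); over `2`, `v₂(q)` even `∧ res8 q = 1 ⟹ q ∈ ℚ_v²`
  (`isSquare_algebraMap_adicCompletion_two_of_res8`); transport along `primesEquiv v = ℓ`
  (`isSquare_algebraMap_adicCompletion_of_padic'`);
* §2 **EXHIBIT ⟹ LOCAL SELMER CONDITION** over a generic `ℚ`-field `E` (a completion): if `a·c₁(T)` and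
  `b·c₂(T)` are squares in `E` for one of `T = O, T₁, T₂, T₃` (descent values `(1,1)`,
  `((e₁−e₂)(e₁−e₃), e₁−e₂)`, `(e₂−e₁, (e₂−e₁)(e₂−e₃))`, `(e₃−e₁, e₃−e₂)`; Silverman X.1.4), or for an
  `E`-point `(x, y)` of `E` (`a·(x−e₁)`, `b·(x−e₂)` squares), then `c(a, b) ∈ selmerLocalKer W E 2`
  (`twoDescentClass_mem_selmerLocalKer_of_isSquare{,_T₁,_T₂,_T₃}`, `…_of_equation`);
* §3 the classes of the TORSION PAIRS (components = the descent values of `T₁`, `T₂`, `T₃`) lie in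
  `Sel⁽²⁾(E/ℚ)` — they are the Kummer images `κ(Tᵢ)`, exhibited everywhere locally by `Tᵢ` itself
  (`twoDescentClass_mem_selmerGroup_T₁/T₂/T₃`).

Design note: in §2 the field `E` is GENERIC and `CharZero E` a plain hypothesis `hE` (made an instance only
inside the proofs). A `CharZero` instance on a concrete completion `ℚ_v` of `ℚ` lets Mathlib's
`DivisionRing.toRatAlgebra` compete with the completion's own `ℚ`-algebra structure in `algebraMap ℚ ℚ_v`;
consumers therefore pass `hE` as a TERM and never as a local instance. Theorems only; no named fact.
Cell `bsd-monsky` (prover-B): the `≥` half of Monsky's `2`-Selmer formula (appendix to Heath-Brown 1994).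

## References

* [SilvermanAEC2009] J. H. Silverman, *The Arithmetic of Elliptic Curves*, 2nd ed., GTM 106, Springer
  2009, Prop. X.1.4, Example X.1.5, Prop. X.4.9.
* [Serre1973] J.-P. Serre, *A Course in Arithmetic*, Ch. II §3.3 Thm 3, Thm 4.
-/

noncomputable section

open scoped Classical

open WeierstrassCurve WeierstrassCurve.Affine WeierstrassCurve.Affine.Point
open Literature.NumberTheory.GaloisRepresentations
open Literature.NumberTheory.EllipticCurves.KramerTwoDescent
open Literature.NumberTheory.EllipticCurves.TwoDescentLocal
open Literature.NumberTheory.QuadraticForms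
open IsDedekindDomain NumberField Rat.HeightOneSpectrum

namespace Literature.NumberTheory.EllipticCurves

namespace TwoDescentLocal

/-! ## §1 Square tests at the places of `ℚ`, in the tree's rational currency -/

/-- Transport from `ℚ_ℓ` to `ℚ_v` along an identification `primesEquiv v = ℓ` of the prime under `v`
(`isSquare_algebraMap_adicCompletion_of_padic`). [cite: SilvermanAEC2009, X.§1 (Example X.1.5)] -/
theorem isSquare_algebraMap_adicCompletion_of_padic' (v : HeightOneSpectrum (𝓞 ℚ)) {ℓ : ℕ} [Fact ℓ.Prime]
    (hv : (primesEquiv v : ℕ) = ℓ) {q : ℚ} (h : IsSquare ((q : ℚ) : ℚ_[ℓ])) :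
    IsSquare (algebraMap ℚ (v.adicCompletion ℚ) q) := by
  subst hv
  exact isSquare_algebraMap_adicCompletion_of_padic v h

/-- The square test at a finite place of `ℚ` over an odd prime `ℓ`, in the tree's rational currency:
`q ≠ 0` with `parityBit ℓ q = 0` and `qrBit ℓ q = 0` is a square in `ℚ_v`.
[cite: Serre1973, Ch. II §3.3 Thm 3] -/
theorem isSquare_algebraMap_adicCompletion_of_bits (v : HeightOneSpectrum (𝓞 ℚ)) {ℓ : ℕ} [Fact ℓ.Prime]
    (hv : (primesEquiv v : ℕ) = ℓ) (hℓ2 : ℓ ≠ 2) {q : ℚ} (hq : q ≠ 0) (hpar : parityBit ℓ q = 0)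
    (hqr : qrBit ℓ q = 0) : IsSquare (algebraMap ℚ (v.adicCompletion ℚ) q) :=
  isSquare_algebraMap_adicCompletion_of_padic' v hv
    (isSquare_ratCast_padic_of_qrBit_eq_zero ℓ hℓ2 hq (parityBit_eq_zero_iff.mp hpar) hqr)

/-- The square test at the place of `ℚ` above `2`: `q ≠ 0` with `v₂(q)` even and odd part `≡ 1 (mod 8)` is
a square in `ℚ_v`. [cite: Serre1973, Ch. II §3.3 Thm 4] -/
theorem isSquare_algebraMap_adicCompletion_two_of_res8 (v : HeightOneSpectrum (𝓞 ℚ))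
    (hv : (primesEquiv v : ℕ) = 2) {q : ℚ} (hq : q ≠ 0) (hpar : Even (padicValRat 2 q)) (h8 : res8 q = 1) :
    IsSquare (algebraMap ℚ (v.adicCompletion ℚ) q) :=
  haveI : Fact (Nat.Prime 2) := ⟨Nat.prime_two⟩
  isSquare_algebraMap_adicCompletion_of_padic' v hv (isSquare_ratCast_padic_two_of_res8_eq_one hq hpar h8)

/-! ## §2 From a local exhibit to the local Selmer condition, over any completion `E` of `ℚ`

The completion is a GENERIC `ℚ`-field `E` here and its characteristic-zero property a plain hypothesis
`hE` (made an instance only inside the proofs): this keeps `algebraMap ℚ E` the given `ℚ`-algebra structure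
(a `CharZero` instance on a completion of `ℚ` would let `DivisionRing.toRatAlgebra` compete with it). -/

section Exhibit

variable (W : WeierstrassCurve ℚ) [W.IsElliptic] {e₁ e₂ e₃ : ℚ} (h : W.toAffine.SplitTwoTorsion e₁ e₂ e₃)
variable (E : Type) [Field E] [Algebra ℚ E]

/-- **Exhibit `O` ⟹ local condition**: if `a`, `b` are squares in `E`, the class `c(a, b)` lies in the local
Selmer kernel at `E`. [cite: SilvermanAEC2009, Prop. X.1.4, Prop. X.4.9] -/
theorem twoDescentClass_mem_selmerLocalKer_of_isSquare (hE : CharZero E) (a b : ℚˣ)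
    (ha : IsSquare (algebraMap ℚ E (a : ℚ))) (hb : IsSquare (algebraMap ℚ E (b : ℚ))) :
    W.twoDescentClass h a b ∈ selmerLocalKer W E 2 := by
  haveI := hE
  haveI := W.isElliptic_baseChange E
  obtain ⟨P, hPa, hPb⟩ := W.exists_twoDescentComponent_pair_eq_of_isSquare E (e₁ := e₁) (e₂ := e₂) (e₃ := e₃)
    a b ha hb
  exact W.mem_selmerLocalKer_of_twoDescentComponent_eq E h a b (W.kummerEquiv_twoTorsionCharH1_twoDescentClass h a b)
    (W.kummerEquiv_twoTorsionCharH1_swap_twoDescentClass h a b) P hPa hPb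

/-- **Exhibit `T₁` ⟹ local condition**: if `a·(e₁−e₂)(e₁−e₃)` and `b·(e₁−e₂)` are squares in `E`, the class
`c(a, b)` lies in the local Selmer kernel at `E`. [cite: SilvermanAEC2009, Prop. X.1.4, Prop. X.4.9] -/
theorem twoDescentClass_mem_selmerLocalKer_of_isSquare_T₁ (hE : CharZero E) (a b : ℚˣ)
    (ha : IsSquare (algebraMap ℚ E ((a : ℚ) * ((e₁ - e₂) * (e₁ - e₃)))))
    (hb : IsSquare (algebraMap ℚ E ((b : ℚ) * (e₁ - e₂)))) :
    W.twoDescentClass h a b ∈ selmerLocalKer W E 2 := by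
  haveI := hE
  haveI := W.isElliptic_baseChange E
  obtain ⟨P, hPa, hPb⟩ := W.exists_twoDescentComponent_pair_eq_of_isSquare_T₁ E h a b ha hb
  exact W.mem_selmerLocalKer_of_twoDescentComponent_eq E h a b (W.kummerEquiv_twoTorsionCharH1_twoDescentClass h a b)
    (W.kummerEquiv_twoTorsionCharH1_swap_twoDescentClass h a b) P hPa hPb

/-- **Exhibit `T₂` ⟹ local condition**: if `a·(e₂−e₁)` and `b·(e₂−e₁)(e₂−e₃)` are squares in `E`, the class
`c(a, b)` lies in the local Selmer kernel at `E`. [cite: SilvermanAEC2009, Prop. X.1.4, Prop. X.4.9] -/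
theorem twoDescentClass_mem_selmerLocalKer_of_isSquare_T₂ (hE : CharZero E) (a b : ℚˣ)
    (ha : IsSquare (algebraMap ℚ E ((a : ℚ) * (e₂ - e₁))))
    (hb : IsSquare (algebraMap ℚ E ((b : ℚ) * ((e₂ - e₁) * (e₂ - e₃))))) :
    W.twoDescentClass h a b ∈ selmerLocalKer W E 2 := by
  haveI := hE
  haveI := W.isElliptic_baseChange E
  obtain ⟨P, hPa, hPb⟩ := W.exists_twoDescentComponent_pair_eq_of_isSquare_T₂ E h a b ha hb
  exact W.mem_selmerLocalKer_of_twoDescentComponent_eq E h a b (W.kummerEquiv_twoTorsionCharH1_twoDescentClass h a b)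
    (W.kummerEquiv_twoTorsionCharH1_swap_twoDescentClass h a b) P hPa hPb

/-- **Exhibit `T₃` ⟹ local condition**: if `a·(e₃−e₁)` and `b·(e₃−e₂)` are squares in `E`, the class `c(a, b)`
lies in the local Selmer kernel at `E`. [cite: SilvermanAEC2009, Prop. X.1.4, Prop. X.4.9] -/
theorem twoDescentClass_mem_selmerLocalKer_of_isSquare_T₃ (hE : CharZero E) (a b : ℚˣ)
    (ha : IsSquare (algebraMap ℚ E ((a : ℚ) * (e₃ - e₁))))
    (hb : IsSquare (algebraMap ℚ E ((b : ℚ) * (e₃ - e₂)))) :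
    W.twoDescentClass h a b ∈ selmerLocalKer W E 2 := by
  haveI := hE
  haveI := W.isElliptic_baseChange E
  obtain ⟨P, hPa, hPb⟩ := W.exists_twoDescentComponent_pair_eq_of_isSquare_T₃ E h a b ha hb
  exact W.mem_selmerLocalKer_of_twoDescentComponent_eq E h a b (W.kummerEquiv_twoTorsionCharH1_twoDescentClass h a b)
    (W.kummerEquiv_twoTorsionCharH1_swap_twoDescentClass h a b) P hPa hPb

/-- **Exhibit an `E`-point `(x, y)` ⟹ local condition**: if `(x, y)` satisfies the equation of `E` over `E`,
`x ≠ e₁, e₂`, and `a·(x − e₁)`, `b·(x − e₂)` are squares in `E`, the class `c(a, b)` lies in the local Selmer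
kernel at `E`. [cite: SilvermanAEC2009, Prop. X.1.4, Prop. X.4.9] -/
theorem twoDescentClass_mem_selmerLocalKer_of_equation (hE : CharZero E) (a b : ℚˣ) {x y : E}
    (hxy : (W.baseChange E).toAffine.Equation x y) (hx₁ : x ≠ algebraMap ℚ E e₁) (hx₂ : x ≠ algebraMap ℚ E e₂)
    (ha : IsSquare (algebraMap ℚ E (a : ℚ) * (x - algebraMap ℚ E e₁)))
    (hb : IsSquare (algebraMap ℚ E (b : ℚ) * (x - algebraMap ℚ E e₂))) :
    W.twoDescentClass h a b ∈ selmerLocalKer W E 2 := by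
  haveI := hE
  haveI := W.isElliptic_baseChange E
  have hns : (W.baseChange E).toAffine.Nonsingular x y := ((W.baseChange E).toAffine.equation_iff_nonsingular).mp hxy
  obtain ⟨P, hPa, hPb⟩ := W.exists_twoDescentComponent_pair_eq_of_nonsingular E (e₃ := e₃) a b hns hx₁ hx₂ ha hb
  exact W.mem_selmerLocalKer_of_twoDescentComponent_eq E h a b (W.kummerEquiv_twoTorsionCharH1_twoDescentClass h a b)
    (W.kummerEquiv_twoTorsionCharH1_swap_twoDescentClass h a b) P hPa hPb

end Exhibit

/-! ## §3 The classes of the torsion pairs are Selmer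

The class of `H¹(ℚ, E[2])` whose components ARE the descent values of a rational `2`-torsion point `T`
(`((e₁−e₂)(e₁−e₃), e₁−e₂)` for `T₁`, etc.) is everywhere locally exhibited by `T` itself (`a·c₁(T) = c₁(T)²`),
hence lies in `Sel⁽²⁾(E/ℚ)` — it is the Kummer image `κ(T)` (Silverman X.1.4: `E(K)/2E(K) ↪ Sel⁽²⁾`), obtained
here without the global Kummer map. -/

section TorsionPairs

variable (W : WeierstrassCurve ℚ) [W.IsElliptic] {e₁ e₂ e₃ : ℚ} (h : W.toAffine.SplitTwoTorsion e₁ e₂ e₃)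

/-- `ℚ_v` has characteristic zero (a term, deliberately NOT a local instance: see §2). [folklore] -/
private theorem charZero_adicCompletion_rat (v : HeightOneSpectrum (𝓞 ℚ)) : CharZero (v.adicCompletion ℚ) :=
  charZero_of_injective_algebraMap (algebraMap ℚ (v.adicCompletion ℚ)).injective

/-- `ℚ_w` has characteristic zero (a term, not a local instance). [folklore] -/
private theorem charZero_completion_rat (w : InfinitePlace ℚ) : CharZero w.Completion :=
  charZero_of_injective_algebraMap (algebraMap ℚ w.Completion).injective

/-- `algebraMap (x · x)` is a square. [folklore] -/
private theorem isSquare_algebraMap_mul_self {E : Type} [Field E] [Algebra ℚ E] (x : ℚ) :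
    IsSquare (algebraMap ℚ E (x * x)) :=
  ⟨algebraMap ℚ E x, map_mul _ _ _⟩

/-- **The class of the torsion pair of `T₁` is Selmer**: if `a = (e₁−e₂)(e₁−e₃)` and `b = e₁−e₂` then
`c(a, b) ∈ Sel⁽²⁾(E/ℚ)` (it is `κ(T₁)`). [cite: SilvermanAEC2009, Prop. X.1.4, Thm. X.4.2] -/
theorem twoDescentClass_mem_selmerGroup_T₁ (a b : ℚˣ) (ha : (a : ℚ) = (e₁ - e₂) * (e₁ - e₃))
    (hb : (b : ℚ) = e₁ - e₂) : W.twoDescentClass h a b ∈ W.selmerGroup 2 := by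
  rw [mem_selmerGroup_iff]
  refine ⟨fun v => ?_, fun w => ?_⟩
  · exact twoDescentClass_mem_selmerLocalKer_of_isSquare_T₁ W h _ (charZero_adicCompletion_rat v) a b
      (by rw [← ha]; exact isSquare_algebraMap_mul_self _) (by rw [← hb]; exact isSquare_algebraMap_mul_self _)
  · exact twoDescentClass_mem_selmerLocalKer_of_isSquare_T₁ W h _ (charZero_completion_rat w) a b
      (by rw [← ha]; exact isSquare_algebraMap_mul_self _) (by rw [← hb]; exact isSquare_algebraMap_mul_self _)

/-- **The class of the torsion pair of `T₂` is Selmer**: if `a = e₂−e₁` and `b = (e₂−e₁)(e₂−e₃)` then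
`c(a, b) ∈ Sel⁽²⁾(E/ℚ)` (it is `κ(T₂)`). [cite: SilvermanAEC2009, Prop. X.1.4, Thm. X.4.2] -/
theorem twoDescentClass_mem_selmerGroup_T₂ (a b : ℚˣ) (ha : (a : ℚ) = e₂ - e₁)
    (hb : (b : ℚ) = (e₂ - e₁) * (e₂ - e₃)) : W.twoDescentClass h a b ∈ W.selmerGroup 2 := by
  rw [mem_selmerGroup_iff]
  refine ⟨fun v => ?_, fun w => ?_⟩
  · exact twoDescentClass_mem_selmerLocalKer_of_isSquare_T₂ W h _ (charZero_adicCompletion_rat v) a b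
      (by rw [← ha]; exact isSquare_algebraMap_mul_self _) (by rw [← hb]; exact isSquare_algebraMap_mul_self _)
  · exact twoDescentClass_mem_selmerLocalKer_of_isSquare_T₂ W h _ (charZero_completion_rat w) a b
      (by rw [← ha]; exact isSquare_algebraMap_mul_self _) (by rw [← hb]; exact isSquare_algebraMap_mul_self _)

/-- **The class of the torsion pair of `T₃` is Selmer**: if `a = e₃−e₁` and `b = e₃−e₂` then
`c(a, b) ∈ Sel⁽²⁾(E/ℚ)` (it is `κ(T₃)`). [cite: SilvermanAEC2009, Prop. X.1.4, Thm. X.4.2] -/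
theorem twoDescentClass_mem_selmerGroup_T₃ (a b : ℚˣ) (ha : (a : ℚ) = e₃ - e₁) (hb : (b : ℚ) = e₃ - e₂) :
    W.twoDescentClass h a b ∈ W.selmerGroup 2 := by
  rw [mem_selmerGroup_iff]
  refine ⟨fun v => ?_, fun w => ?_⟩
  · exact twoDescentClass_mem_selmerLocalKer_of_isSquare_T₃ W h _ (charZero_adicCompletion_rat v) a b
      (by rw [← ha]; exact isSquare_algebraMap_mul_self _) (by rw [← hb]; exact isSquare_algebraMap_mul_self _)
  · exact twoDescentClass_mem_selmerLocalKer_of_isSquare_T₃ W h _ (charZero_completion_rat w) a b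
      (by rw [← ha]; exact isSquare_algebraMap_mul_self _) (by rw [← hb]; exact isSquare_algebraMap_mul_self _)

end TorsionPairs

end TwoDescentLocal

end Literature.NumberTheory.EllipticCurves

end
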